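import Summits.HodgeConjecture.HodgeConjecture.Theorems.K2E1bDatumCubicScalar          -- 8b-β part 1 (K2E4-p10 (g3)): `cubicScalar_ofRecord_levelOne`, `localMin_package`, `casimirScalar_eq_of_hasChiScalars`, `eq_cubicOf_of_hasCubicPin_dsClsOfRecord`
import Literature.RepresentationTheory.Kovacevic2021.SU21VertexRigidity                -- ★ `exists_isLocalMin`, `exists_lower_of_ne`
import Literature.RepresentationTheory.Kovacevic2021.SU21CohomologicalClassification   -- ★ `forall_reach_of_isIrreducible`
import Literature.RepresentationTheory.Kovacevic2021.SU21UnitarityNecessary            -- ★ `prodAD_of_isUnitarizable`, `prodBC_of_isUnitarizable`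
import Summits.HodgeConjecture.HodgeConjecture.Theorems.K2E1bUnitaryDualOfParts           -- ★ Q12 p857054: `DatumUnitaryDualStmt` (the socket's statement name)
import HarnessLib

/-!
# K2 ∕ E1b unit U8, brick 8b-β (part 2 of 2) `K2E1bDatumUnitaryDual`: THE DATUM-LEVEL UNITARY DUAL OF `U(2,1)` AT A REGULAR INTEGRAL
# INFINITESIMAL CHARACTER — an irreducible unitarizable Kovačević datum with the χ-scalars and the cubic pin of `Π(φ(a,b,c))` IS one of the three cells

HCML Track B «K2-LIT», cell `hodgecm-mathlib`, crux H413 = stmt-HodgeConjecture-24833 (supports-only helper; closes nothing by itself).  Brick **8b-β**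
«datum-level unitary dual at regular χ» of the TABLE `Lines/K2_E1b_GKCohomologyU21_U8_ArchPacketSigns.md` ED. 8 §2d; DEAL K2E1b-plan (g3) → K2E4-p10 (g3)
2026-09-04T03:13:37Z, HEAD `datumUnitaryDual_at_regular` token for token (= the body of the dealer's `DatumUnitaryDualStmt` in the Q12 glue
`K2E1bUnitaryDualOfParts`), OUTPUT CURRENCY = the inputs `hS hP hQ` of ★ 8b-γ `K2E1bDSRecordRecognition.mk_ofRecord_eq_dsClsOfRecord`.
THEOREMS ONLY (no `def`, no `sorry`, no instance declaration, no notation); `datumUnitaryDualStmt_holds : DatumUnitaryDualStmt` is the BY-NAME tie.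
## The statement

For a regular parameter `a ≥ b+2`, `b ≥ c+2` (★ `IsRegularParam`), `j : Fin 3`, and a Kovačević datum `𝒟` (★ `SU21Datum`) whose `𝔤𝔩(3,ℂ)`-module is
irreducible and unitarizable (★ `IsUnitarizable`), whose structure of record `σOfRecord 𝒟 e` (★ #23, `e = centralOf a b c`) has the χ-scalars
`(κ, e) = (casimirOf a b c, centralOf a b c)` (★ `HasChiScalars`) and a cubic scalar `s` (★ `HasCubicScalar`) that is a cubic pin of the record class
`dsClsOfRecord a b c j` (★ `HasCubicPin`): there is `i : Fin 3` with `𝒟.S = (dsCellDatum i a b c).S` and the same invariant products `A D′`, `B C′` everywhere.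

## The proof (vertex rigidity + power sums; no principal-series enumeration)

1. χ ⇒ datum scalars (part 1): `c_{n,m} = κ₀ := κ − e²∕3` on `S` (★ `casimirScalar_eq_of_hasChiScalars`), `s = cubicOf a b c` (★ `eq_cubicOf_of_hasCubicPin_dsClsOfRecord`).
2. VERTEX: `𝒟` is strongly connected (★ `forall_reach_of_isIrreducible`) with a local minimum `x₀ = (n, m)` (★ `exists_isLocalMin`): by part 1's vertex packages
   the Casimir and cubic equations at `x₀` are EXPLICIT polynomial equations in `(n, m)` (and in `c_{1,m} = κ₀` on the level `n = 1`).
3. DIOPHANTINE CORE (Bezout `2·3 = 6 = |W(𝔤𝔩₃)|`): for `n ≥ 2`, with `A′ = 2e+m+3n−3`, `B′ = 2e−2m`, `C′ = 2e+m−3n+3` the two equations say that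
   `(A′,B′,C′)` and `(6a,6b,6c)` have the same power sums `p₁, p₂, p₃`, whence `(X−6a)(X−6b)(X−6c)` vanishes at `A′, B′, C′`
   (`vertex_of_powerSums`: explicit `linear_combination`s, then `omega`) ⇒ `x₀ ∈ {(a−c+1, a+c−2b), (a−b+1, a+b−2c), (b−c+1, b+c−2a)}` = the vertices of
   `D_φ, J_φ⁺, J_φ⁻`; for `n = 1`, `(m − 2t⁺)(m − 2t⁻)(m − 2t″) = 0` (`levelOne_vertex`) ⇒ the cone vertices of `D_φ⁺, D_φ⁻, F_φ`.
4. UNITARITY CUT (★ `prodAD∕BC_of_isUnitarizable`: invariant products along edges are non-positive reals): at the `J_φ⁺`-vertex `(n+1)·B C′ = b−c−1 > 0`,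
   at the `J_φ⁻`-vertex `(n+1)·A D′ = a−b−1 > 0`, at the `F_φ`-vertex `A D′ = (a−b−1)(b−c+1)∕2 > 0` — contradictions (Rogawski1990 §12.3 [Wallach]; no model needed).
5. UNIQUE CONTINUATION from the common vertex (`mem_iff_and_products_eq_of_vertex_of_casimir`: ★ `mem_iff_and_products_eq_of_vertex` with level-one
   Casimir scalar `κ₀` for `0`) against `dsCellDatum i a b c` (★ `dsCellDatum_vertex_zero`∕`_coneVertex_one∕two`, ★ `dsCellDatum_reach`, ★ `dsCellDatum_casimirScalar`).

Sources: [Kovacevic2021] §3 Thm 2–3, Remark 3, §4 Thm 4–5; [Rogawski1990] §12.2–12.3 pp. 175–178; [BorelWallach2000] VI §4 4.10–4.12; [Iachello2015] (7.20)–(7.24).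
HONEST LABEL: 8b-β is one brick of socket 8b (`UnitaryDualWith`; with 8b-α «abstract → datum» and ★ 8b-γ); it closes nothing by itself; HC_CM is proved only
modulo the 7 printed citations (2 remaining named inputs: hLiu418 = stmt-HodgeConjecture-24832, h413 = stmt-HodgeConjecture-24833) until rung 0 closes.
-/

set_option autoImplicit false
set_option linter.dupNamespace false

noncomputable section

namespace Summit.HodgeConjecture.HodgeConjecture.Cruxes.H413.K2E1bDatumUnitaryDual

open Literature.NumberTheory.Automorphic
open Literature.RepresentationTheory
open Literature.RepresentationTheory.BorelWallach2000
open Literature.RepresentationTheory.KonnoKonno2007 Literature.RepresentationTheory.KonnoKonno2007.RealDualPair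
open Literature.RepresentationTheory.KonnoKonno2007.RealDualPair.UForm
open Literature.RepresentationTheory.Kovacevic2021 Literature.RepresentationTheory.Kovacevic2021.SU21Datum
open Summit.HodgeConjecture.HodgeConjecture.Cruxes.H413.F0P3bLocalAPacketsDefs
open Summit.HodgeConjecture.HodgeConjecture.Cruxes.H413.K2E1bGKCohomologyU21
open Summit.HodgeConjecture.HodgeConjecture.Cruxes.H413.K2E1bGKCohomologyU21.U8 (IsRegularParam casimirOf centralOf)
open Summit.HodgeConjecture.HodgeConjecture.Cruxes.H413.K2E1bGKCohomologyU21.U8.LevelB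
open Summit.HodgeConjecture.HodgeConjecture.Cruxes.H413.K2E1bCarriersOfRecord
open Summit.HodgeConjecture.HodgeConjecture.Cruxes.H413.K2E1bDSCellData
open Summit.HodgeConjecture.HodgeConjecture.Cruxes.H413.K2E1bDSClsOfRecord
open Summit.HodgeConjecture.HodgeConjecture.Cruxes.H413.K2E1bDatumCubicScalar

-- Mathlib idiom (Mathlib/Algebra/Lie/OfAssociative.lean): commutator brackets on associative algebras; needed to MENTION the `𝔤𝔩(3,ℂ)`-module `𝒟.V`
-- (`LieModule.IsIrreducible ℂ (Matrix (Fin 3) (Fin 3) ℂ) 𝒟.V` in the head) and `σOfRecord`, exactly as in every ★ Kovačević file and ★ 8b-γ.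
attribute [local instance 100] LieRing.ofAssociativeRing

/-! ## §1 Unique continuation from a common vertex with a prescribed level-one Casimir scalar -/

section Continuation

variable {𝒟₁ 𝒟₂ : SU21Datum} {x₀ : ℤ × ℤ} {κ₀ : ℂ}

/-- membership transfer at one level, given the products one level down (as in ★ `SU21VertexRigidity`) [cite: Kovacevic2021, §3 Thm 2] -/
private theorem mem_of_mem_of_lower (h₂ : x₀ ∈ 𝒟₂.S)
    (hdown₁ : ∀ n m : ℤ, (n, m) ∈ 𝒟₁.S → (n, m) ≠ x₀ →
      𝒟₁.A (n - 1) (m - 3) * 𝒟₁.D n m ≠ 0 ∨ 𝒟₁.B (n - 1) (m + 3) * 𝒟₁.C n m ≠ 0)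
    {n m : ℤ}
    (hP : 𝒟₁.A (n - 1) (m - 3) * 𝒟₁.D n m = 𝒟₂.A (n - 1) (m - 3) * 𝒟₂.D n m)
    (hQ : 𝒟₁.B (n - 1) (m + 3) * 𝒟₁.C n m = 𝒟₂.B (n - 1) (m + 3) * 𝒟₂.C n m)
    (hS : (n, m) ∈ 𝒟₁.S) : (n, m) ∈ 𝒟₂.S := by
  by_cases hx : (n, m) = x₀
  · rw [hx]; exact h₂
  rcases hdown₁ n m hS hx with h | h
  · rw [hP] at h
    by_contra hS₂
    exact h (by rw [𝒟₂.D_eq_zero hS₂, mul_zero])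
  · rw [hQ] at h
    by_contra hS₂
    exact h (by rw [𝒟₂.C_eq_zero hS₂, mul_zero])

/-- **Unique continuation from the vertex, at a general infinitesimal character.**  Two data containing `x₀`, each generated downward to `x₀` (every
`K`-type `(n,m) ≠ x₀` has `A_{n−1,m−3}D_{n,m} ≠ 0` or `B_{n−1,m+3}C_{n,m} ≠ 0`) and with the SAME Casimir scalar `κ₀` on the level `n = 1`, have the same
`K`-types and the same invariant products `A D′`, `B C′` everywhere — ★ `mem_iff_and_products_eq_of_vertex` verbatim with `κ₀` for `0` (induction on the level;
Cramer on (b20), (b25) for `n ≥ 2`; (b20) and the Casimir on `n = 1`, where `κ₀` cancels). [cite: Kovacevic2021, §3 Thm 2 (last sentence), Remark 3] -/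
theorem mem_iff_and_products_eq_of_vertex_of_casimir (h₁ : x₀ ∈ 𝒟₁.S) (h₂ : x₀ ∈ 𝒟₂.S)
    (hdown₁ : ∀ n m : ℤ, (n, m) ∈ 𝒟₁.S → (n, m) ≠ x₀ →
      𝒟₁.A (n - 1) (m - 3) * 𝒟₁.D n m ≠ 0 ∨ 𝒟₁.B (n - 1) (m + 3) * 𝒟₁.C n m ≠ 0)
    (hdown₂ : ∀ n m : ℤ, (n, m) ∈ 𝒟₂.S → (n, m) ≠ x₀ →
      𝒟₂.A (n - 1) (m - 3) * 𝒟₂.D n m ≠ 0 ∨ 𝒟₂.B (n - 1) (m + 3) * 𝒟₂.C n m ≠ 0)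
    (hcas₁ : ∀ m : ℤ, ((1 : ℤ), m) ∈ 𝒟₁.S → 𝒟₁.casimirScalar 1 m = κ₀)
    (hcas₂ : ∀ m : ℤ, ((1 : ℤ), m) ∈ 𝒟₂.S → 𝒟₂.casimirScalar 1 m = κ₀) (n m : ℤ) :
    ((n, m) ∈ 𝒟₁.S ↔ (n, m) ∈ 𝒟₂.S) ∧
      𝒟₁.A n m * 𝒟₁.D (n + 1) (m + 3) = 𝒟₂.A n m * 𝒟₂.D (n + 1) (m + 3) ∧
      𝒟₁.B n m * 𝒟₁.C (n + 1) (m - 3) = 𝒟₂.B n m * 𝒟₂.C (n + 1) (m - 3) := by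
  -- adapted from ★ `SU21VertexRigidity.mem_iff_and_products_eq_of_vertex` (the level-one Casimir scalar `κ₀` cancels in `hc₁ - hc₂`)
  have triv : ∀ n m : ℤ, (n, m) ∉ 𝒟₁.S → (n, m) ∉ 𝒟₂.S →
      ((n, m) ∈ 𝒟₁.S ↔ (n, m) ∈ 𝒟₂.S) ∧
        𝒟₁.A n m * 𝒟₁.D (n + 1) (m + 3) = 𝒟₂.A n m * 𝒟₂.D (n + 1) (m + 3) ∧
        𝒟₁.B n m * 𝒟₁.C (n + 1) (m - 3) = 𝒟₂.B n m * 𝒟₂.C (n + 1) (m - 3) := by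
    intro n m hn₁ hn₂
    refine ⟨⟨fun h => absurd h hn₁, fun h => absurd h hn₂⟩, ?_, ?_⟩
    · rw [𝒟₁.A_eq_zero hn₁, 𝒟₂.A_eq_zero hn₂, zero_mul, zero_mul]
    · rw [𝒟₁.B_eq_zero hn₁, 𝒟₂.B_eq_zero hn₂, zero_mul, zero_mul]
  suffices main : ∀ N : ℕ, ∀ n m : ℤ, n ≤ N →
      ((n, m) ∈ 𝒟₁.S ↔ (n, m) ∈ 𝒟₂.S) ∧
        𝒟₁.A n m * 𝒟₁.D (n + 1) (m + 3) = 𝒟₂.A n m * 𝒟₂.D (n + 1) (m + 3) ∧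
        𝒟₁.B n m * 𝒟₁.C (n + 1) (m - 3) = 𝒟₂.B n m * 𝒟₂.C (n + 1) (m - 3) from
    main n.toNat n m (Int.self_le_toNat n)
  intro N
  induction N with
  | zero =>
    intro n m hn
    exact triv n m (fun h => by have := 𝒟₁.one_le_of_mem h; omega)
      (fun h => by have := 𝒟₂.one_le_of_mem h; omega)
  | succ N ih =>
    intro n m hn
    rcases (show n ≤ (N : ℤ) ∨ n = N + 1 by omega) with hle | hN
    · exact ih n m hle
    have hP : 𝒟₁.A (n - 1) (m - 3) * 𝒟₁.D n m = 𝒟₂.A (n - 1) (m - 3) * 𝒟₂.D n m := by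
      have := (ih (n - 1) (m - 3) (by omega)).2.1
      simpa only [sub_add_cancel] using this
    have hQ : 𝒟₁.B (n - 1) (m + 3) * 𝒟₁.C n m = 𝒟₂.B (n - 1) (m + 3) * 𝒟₂.C n m := by
      have := (ih (n - 1) (m + 3) (by omega)).2.2
      simpa only [sub_add_cancel, add_sub_cancel_right] using this
    have hiff : (n, m) ∈ 𝒟₁.S ↔ (n, m) ∈ 𝒟₂.S :=
      ⟨mem_of_mem_of_lower h₂ hdown₁ hP hQ, mem_of_mem_of_lower h₁ hdown₂ hP.symm hQ.symm⟩
    by_cases hS₁ : (n, m) ∈ 𝒟₁.S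
    swap
    · exact triv n m hS₁ (fun h => hS₁ (hiff.2 h))
    have hS₂ : (n, m) ∈ 𝒟₂.S := hiff.1 hS₁
    refine ⟨hiff, ?_⟩
    have hP' : 𝒟₁.D n m * 𝒟₁.A (n - 1) (m - 3) = 𝒟₂.D n m * 𝒟₂.A (n - 1) (m - 3) := by
      rw [mul_comm, hP, mul_comm]
    have hQ' : 𝒟₁.C n m * 𝒟₁.B (n - 1) (m + 3) = 𝒟₂.C n m * 𝒟₂.B (n - 1) (m + 3) := by
      rw [mul_comm, hQ, mul_comm]
    have e1₁ := 𝒟₁.rel20 hS₁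
    have e1₂ := 𝒟₂.rel20 hS₂
    have e2₁ := 𝒟₁.rel25 hS₁
    have e2₂ := 𝒟₂.rel25 hS₂
    have hn1 : 1 ≤ n := 𝒟₁.one_le_of_mem hS₁
    rcases eq_or_lt_of_le hn1 with hn | hn
    · -- level `n = 1`: (b20) and the Casimir scalar `κ₀`
      subst hn
      have hc₁ := hcas₁ m hS₁
      have hc₂ := hcas₂ m hS₂
      rw [casimirScalar] at hc₁ hc₂
      rw [Int.cast_one] at e1₁ e1₂ hc₁ hc₂
      constructor
      · linear_combination (-1 / 2 : ℂ) * (e1₁ - e1₂) + (1 / 4 : ℂ) * (hc₁ - hc₂)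
      · linear_combination (1 / 2 : ℂ) * (e1₁ - e1₂) + (1 / 4 : ℂ) * (hc₁ - hc₂)
    · -- level `n ≥ 2`: Cramer on (b20), (b25)
      have d1 : -(𝒟₁.A n m * 𝒟₁.D (n + 1) (m + 3) - 𝒟₂.A n m * 𝒟₂.D (n + 1) (m + 3))
          + (n : ℂ) * (𝒟₁.B n m * 𝒟₁.C (n + 1) (m - 3) - 𝒟₂.B n m * 𝒟₂.C (n + 1) (m - 3)) = 0 := by
        linear_combination e1₁ - e1₂ + ((n : ℂ) - 1) * hQ'
      have d2 : -(n : ℂ) * (𝒟₁.A n m * 𝒟₁.D (n + 1) (m + 3) - 𝒟₂.A n m * 𝒟₂.D (n + 1) (m + 3))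
          + (𝒟₁.B n m * 𝒟₁.C (n + 1) (m - 3) - 𝒟₂.B n m * 𝒟₂.C (n + 1) (m - 3)) = 0 := by
        linear_combination e2₁ - e2₂ - ((n : ℂ) - 1) * hP'
      have hdet : ((n : ℂ) ^ 2 - 1) ≠ 0 := by
        have : (n ^ 2 - 1 : ℤ) ≠ 0 := by nlinarith
        exact_mod_cast this
      have d3 : ((n : ℂ) ^ 2 - 1) * (𝒟₁.A n m * 𝒟₁.D (n + 1) (m + 3) - 𝒟₂.A n m * 𝒟₂.D (n + 1) (m + 3)) = 0 := by
        linear_combination d1 - (n : ℂ) * d2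
      have hA : 𝒟₁.A n m * 𝒟₁.D (n + 1) (m + 3) = 𝒟₂.A n m * 𝒟₂.D (n + 1) (m + 3) := by
        have := (mul_eq_zero.1 d3).resolve_left hdet
        exact sub_eq_zero.1 this
      refine ⟨hA, ?_⟩
      linear_combination d2 + (n : ℂ) * hA

end Continuation
/-! ## §2 The Diophantine core (integer arithmetic only) -/

section Diophantine

variable {a b c : ℤ}

/-- **`n ≥ 2`: the Casimir and cubic equations at a local minimum pin the vertex to the Weyl orbit.**  With `A′ = 2e+m+3n−3`, `B′ = 2e−2m`, `C′ = 2e+m−3n+3`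
(`e = a+b+c`) the hypotheses say `p₂(A′,B′,C′) = 36 p₂(a,b,c)` and `p₃ = 216 p₃` (and `p₁ = 6e` identically), so `(X−6a)(X−6b)(X−6c)` vanishes at
`X = A′, B′, C′` (three explicit polynomial identities), and with `a > b > c`, `A′ − C′ = 6(n−1) > 0`, `A′ + B′ + C′ = 6e` only the three listed assignments
survive. [cite: Iachello2015, (7.20)–(7.24)] [cite: Molev2007, Thm. 7.1.1] [cite: Rogawski1990, §12.2 p. 175] -/
theorem vertex_of_powerSums (h : IsRegularParam a b c) {n m : ℤ} (hn : 2 ≤ n)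
    (hconic : 3 * (n - 1) ^ 2 + m ^ 2 = 6 * casimirOf a b c - 2 * centralOf a b c ^ 2 + 12)
    (hcub : 36 * cubicOf a b c = (-81 + 9 * m + 9 * m ^ 2 - m ^ 3 - 54 * n + 27 * n ^ 2 - 18 * m * n + 9 * m * n ^ 2)
      + centralOf a b c * (18 * (n ^ 2 - 1) + 6 * m ^ 2 - 36 * (n + 1)) + 4 * centralOf a b c ^ 3) :
    (n = a - c + 1 ∧ m = a + c - 2 * b) ∨ (n = a - b + 1 ∧ m = a + b - 2 * c) ∨ (n = b - c + 1 ∧ m = b + c - 2 * a) := by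
  obtain ⟨h1, h2⟩ := h
  unfold casimirOf centralOf at hconic
  unfold cubicOf centralOf at hcub
  have hA : (2 * (a + b + c) + m + 3 * n - 3 - 6 * a) * (2 * (a + b + c) + m + 3 * n - 3 - 6 * b) *
      (2 * (a + b + c) + m + 3 * n - 3 - 6 * c) = 0 := by
    linear_combination (3 * (2 * (a + b + c) + m + 3 * n - 3) - 18 * (a + b + c) - 18) * hconic - 2 * hcub
  have hB : (2 * (a + b + c) - 2 * m - 6 * a) * (2 * (a + b + c) - 2 * m - 6 * b) * (2 * (a + b + c) - 2 * m - 6 * c) = 0 := by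
    linear_combination (3 * (2 * (a + b + c) - 2 * m) - 18 * (a + b + c) - 18) * hconic - 2 * hcub
  have hC : (2 * (a + b + c) + m - 3 * n + 3 - 6 * a) * (2 * (a + b + c) + m - 3 * n + 3 - 6 * b) *
      (2 * (a + b + c) + m - 3 * n + 3 - 6 * c) = 0 := by
    linear_combination (3 * (2 * (a + b + c) + m - 3 * n + 3) - 18 * (a + b + c) - 18) * hconic - 2 * hcub
  rcases mul_eq_zero.1 hA with hA | hA <;> [rcases mul_eq_zero.1 hA with hA | hA; skip] <;>
    rcases mul_eq_zero.1 hB with hB | hB <;> (try rcases mul_eq_zero.1 hB with hB | hB) <;>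
    rcases mul_eq_zero.1 hC with hC | hC <;> (try rcases mul_eq_zero.1 hC with hC | hC) <;> omega

/-- **`n = 1`: the cubic equation at a level-one vertex is `(m − 2t⁺)(m − 2t⁻)(m − 2t″) = 0`** (`t⁺ = 2a−b−c`, `t⁻ = 2c−a−b`, `t″ = 2b−a−c`; the three
principal series through `χ_φ`). [cite: Kovacevic2021, §3 Thm 3, Remark 3] [cite: Rogawski1990, §12.3 p. 177] [cite: Iachello2015, (7.24)] -/
theorem levelOne_vertex {m : ℤ}
    (hcub : 72 * cubicOf a b c = -2 * m ^ 3 + (18 * casimirOf a b c - 6 * centralOf a b c ^ 2 - 3 * m ^ 2) * (6 - m) + 18 * m ^ 2 - 36 * m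
      + 72 * centralOf a b c * casimirOf a b c - 16 * centralOf a b c ^ 3) :
    m = 2 * tPlus a b c ∨ m = 2 * tMinus a b c ∨ m = 2 * tBox a b c := by
  unfold cubicOf casimirOf centralOf at hcub
  have hprod : (m - 2 * tPlus a b c) * (m - 2 * tMinus a b c) * (m - 2 * tBox a b c) = 0 := by
    unfold tPlus tMinus tBox
    linear_combination (-1 : ℤ) * hcub
  rcases mul_eq_zero.1 hprod with h' | h'
  · rcases mul_eq_zero.1 h' with h' | h'
    · exact Or.inl (by omega)
    · exact Or.inr (Or.inl (by omega))
  · exact Or.inr (Or.inr (by omega))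

end Diophantine

/-! ## §3 Unitarity at a vertex -/

section Unitarity

variable {𝒟 : SU21Datum}

/-- On a unitarizable datum `A_{n,m}D_{n+1,m+3}` is a non-positive real at every `K`-type (★ `prodAD_of_isUnitarizable` if `(n+1, m+3)` is a `K`-type, and
`D_{n+1,m+3} = 0` otherwise). [cite: Kovacevic2021, §4 Thm 4] -/
theorem prodAD_real_nonpos (hU : IsUnitarizable 𝒟) {n m : ℤ} (hS : (n, m) ∈ 𝒟.S) :
    (𝒟.A n m * 𝒟.D (n + 1) (m + 3)).im = 0 ∧ (𝒟.A n m * 𝒟.D (n + 1) (m + 3)).re ≤ 0 := by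
  by_cases h' : (n + 1, m + 3) ∈ 𝒟.S
  · exact ⟨(prodAD_of_isUnitarizable 𝒟 hU hS h').1, (prodAD_of_isUnitarizable 𝒟 hU hS h').2.1⟩
  · rw [𝒟.D_eq_zero h', mul_zero]; simp

/-- On a unitarizable datum `B_{n,m}C_{n+1,m−3}` is a non-positive real at every `K`-type. [cite: Kovacevic2021, §4 Thm 4] -/
theorem prodBC_real_nonpos (hU : IsUnitarizable 𝒟) {n m : ℤ} (hS : (n, m) ∈ 𝒟.S) :
    (𝒟.B n m * 𝒟.C (n + 1) (m - 3)).im = 0 ∧ (𝒟.B n m * 𝒟.C (n + 1) (m - 3)).re ≤ 0 := by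
  by_cases h' : (n + 1, m - 3) ∈ 𝒟.S
  · exact ⟨(prodBC_of_isUnitarizable 𝒟 hU hS h').1, (prodBC_of_isUnitarizable 𝒟 hU hS h').2.1⟩
  · rw [𝒟.C_eq_zero h', mul_zero]; simp

/-- arithmetic: if `z` is a non-positive real and `k·z = t∕2` with an integer `k > 0`, then the integer `t` is `≤ 0` [folklore] -/
theorem int_nonpos_of_mul_eq {z : ℂ} {k t : ℤ} (hz : z.im = 0 ∧ z.re ≤ 0) (hk : 0 < k)
    (h : ((k : ℤ) : ℂ) * z = ((t : ℤ) : ℂ) / 2) : t ≤ 0 := by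
  have h2 : (((2 * k : ℤ) : ℝ) : ℂ) * z = (((t : ℤ) : ℝ) : ℂ) := by
    push_cast
    linear_combination 2 * h
  have h3 := congrArg Complex.re h2
  rw [Complex.re_ofReal_mul, Complex.ofReal_re] at h3
  have hk' : (0 : ℝ) ≤ ((2 * k : ℤ) : ℝ) := by exact_mod_cast (by omega : (0 : ℤ) ≤ 2 * k)
  have : ((t : ℤ) : ℝ) ≤ 0 := by rw [← h3]; exact mul_nonpos_of_nonneg_of_nonpos hk' hz.2
  exact_mod_cast this

end Unitarity

/-! ## §4 The vertex of `𝒟` and the head -/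

section Main

variable {a b c : ℤ}

/-- **THE VERTEX OF `𝒟` IS A CELL VERTEX.**  Under the hypotheses of the head, a local minimum `(n, m)` of `𝒟` is the local-minimum vertex `(a−c+1, a+c−2b)` of
`D_φ` or the cone vertex `(1, 2t^±)` of `D_φ^±` (§2 pins it to the six vertices of `Π(χ_φ) ∪ {F_φ, J_φ^±}`, §3 excludes `F_φ, J_φ^±` by the sign of one vertex
product). [cite: Rogawski1990, §12.3 pp. 176–178] [cite: Kovacevic2021, §3 Thm 2–3, §4 Thm 4–5] [cite: BorelWallach2000, VI §4 4.12] -/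
theorem vertex_eq_of_pins (h : IsRegularParam a b c) (j : Fin 3) (𝒟 : SU21Datum)
    (hirr : LieModule.IsIrreducible ℂ (Matrix (Fin 3) (Fin 3) ℂ) 𝒟.V) (hU : IsUnitarizable 𝒟)
    (hχ : HasChiScalars (σOfRecord 𝒟 (centralOf a b c)) (casimirOf a b c) (centralOf a b c))
    {s : ℂ} (hs : HasCubicScalar (σOfRecord 𝒟 (centralOf a b c)) s) (hpin : HasCubicPin (dsClsOfRecord a b c j) s)
    {n m : ℤ} (hS : (n, m) ∈ 𝒟.S) (hD : (n - 1, m - 3) ∉ 𝒟.S) (hC : (n - 1, m + 3) ∉ 𝒟.S) :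
    (n, m) = (a - c + 1, a + c - 2 * b) ∨ (n, m) = (1, 2 * tPlus a b c) ∨ (n, m) = (1, 2 * tMinus a b c) := by
  obtain ⟨h1, h2⟩ := id h
  have hκ := casimirScalar_eq_of_hasChiScalars 𝒟 hirr hχ hS
  have hsval : s = ((cubicOf a b c : ℤ) : ℂ) := eq_cubicOf_of_hasCubicPin_dsClsOfRecord h j hpin
  have hn1 : 1 ≤ n := 𝒟.one_le_of_mem hS
  rcases lt_or_ge n 2 with hn | hn
  · -- level `n = 1`
    obtain rfl : n = 1 := by omega
    obtain ⟨hP, -, hG⟩ := cubicScalar_ofRecord_levelOne 𝒟 (centralOf a b c) hs hS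
    rw [hκ] at hP hG
    rw [hsval] at hG
    have hcubZ : 72 * cubicOf a b c = -2 * m ^ 3 + (18 * casimirOf a b c - 6 * centralOf a b c ^ 2 - 3 * m ^ 2) * (6 - m)
        + 18 * m ^ 2 - 36 * m + 72 * centralOf a b c * casimirOf a b c - 16 * centralOf a b c ^ 3 := by
      have : ((72 * cubicOf a b c : ℤ) : ℂ) = ((-2 * m ^ 3 + (18 * casimirOf a b c - 6 * centralOf a b c ^ 2 - 3 * m ^ 2) * (6 - m)
          + 18 * m ^ 2 - 36 * m + 72 * centralOf a b c * casimirOf a b c - 16 * centralOf a b c ^ 3 : ℤ) : ℂ) := by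
        push_cast
        linear_combination 72 * hG
      exact_mod_cast this
    rcases levelOne_vertex hcubZ with hm | hm | hm
    · exact Or.inr (Or.inl (by rw [hm]))
    · exact Or.inr (Or.inr (by rw [hm]))
    · -- `F_φ`: `A D′ = (a−b−1)(b−c+1)∕2 > 0`
      exfalso
      have hval : ((1 : ℤ) : ℂ) * (𝒟.A 1 m * 𝒟.D (1 + 1) (m + 3)) = (((a - b - 1) * (b - c + 1) : ℤ) : ℂ) / 2 := by
        rw [hP, hm]
        push_cast [casimirOf, centralOf, tBox]
        ring
      have := int_nonpos_of_mul_eq (prodAD_real_nonpos hU hS) one_pos hval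
      nlinarith
  · -- level `n ≥ 2`
    obtain ⟨hP, hQ, hK, hG⟩ := localMin_package 𝒟 (centralOf a b c) hs hS hD hC hn
    have hKκ := hκ.symm.trans hK
    rw [hsval] at hG
    have hconic : 3 * (n - 1) ^ 2 + m ^ 2 = 6 * casimirOf a b c - 2 * centralOf a b c ^ 2 + 12 := by
      have : ((3 * (n - 1) ^ 2 + m ^ 2 : ℤ) : ℂ) = ((6 * casimirOf a b c - 2 * centralOf a b c ^ 2 + 12 : ℤ) : ℂ) := by
        push_cast
        linear_combination (-6 : ℂ) * hKκ
      exact_mod_cast this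
    have hcubZ : 36 * cubicOf a b c = (-81 + 9 * m + 9 * m ^ 2 - m ^ 3 - 54 * n + 27 * n ^ 2 - 18 * m * n + 9 * m * n ^ 2)
        + centralOf a b c * (18 * (n ^ 2 - 1) + 6 * m ^ 2 - 36 * (n + 1)) + 4 * centralOf a b c ^ 3 := by
      have : ((36 * cubicOf a b c : ℤ) : ℂ) = (((-81 + 9 * m + 9 * m ^ 2 - m ^ 3 - 54 * n + 27 * n ^ 2 - 18 * m * n + 9 * m * n ^ 2)
          + centralOf a b c * (18 * (n ^ 2 - 1) + 6 * m ^ 2 - 36 * (n + 1)) + 4 * centralOf a b c ^ 3 : ℤ) : ℂ) := by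
        push_cast
        linear_combination hG
      exact_mod_cast this
    rcases vertex_of_powerSums h hn hconic hcubZ with ⟨hn', hm'⟩ | ⟨hn', hm'⟩ | ⟨hn', hm'⟩
    · exact Or.inl (by rw [hn', hm'])
    · -- `J_φ⁺`: `(n+1)·B C′ = b − c − 1 > 0`
      exfalso
      have hval : ((n + 1 : ℤ) : ℂ) * (𝒟.B n m * 𝒟.C (n + 1) (m - 3)) = ((2 * (b - c - 1) : ℤ) : ℂ) / 2 := by
        push_cast
        rw [hQ, hn', hm']
        push_cast
        ring
      have := int_nonpos_of_mul_eq (prodBC_real_nonpos hU hS) (by omega) hval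
      omega
    · -- `J_φ⁻`: `(n+1)·A D′ = a − b − 1 > 0`
      exfalso
      have hval : ((n + 1 : ℤ) : ℂ) * (𝒟.A n m * 𝒟.D (n + 1) (m + 3)) = ((2 * (a - b - 1) : ℤ) : ℂ) / 2 := by
        push_cast
        rw [hP, hn', hm']
        push_cast
        ring
      have := int_nonpos_of_mul_eq (prodAD_real_nonpos hU hS) (by omega) hval
      omega

/-- **8b-β — THE DATUM-LEVEL UNITARY DUAL OF `U(2,1)` AT A REGULAR INTEGRAL INFINITESIMAL CHARACTER** (HEAD, token for token = the body of
`DatumUnitaryDualStmt` of the Q12 glue).  An irreducible unitarizable Kovačević datum whose structure of record at `e = centralOf a b c` has the χ-scalars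
`(casimirOf a b c, centralOf a b c)` and a cubic scalar pinned to the record cell `j` has the `K`-types and the invariant products of one of the three cells
`dsCellDatum i a b c` (`D_φ, D_φ⁺, D_φ⁻`) — Rogawski's `Π(φ) ∩ Ĝ_unitary = {D, D⁺, D⁻}` at regular `φ`, in E1b currency, as the inputs `hS hP hQ` of ★ 8b-γ.
Proof: §4 `vertex_eq_of_pins` + §1 from the common vertex against the cell (★ `dsCellDatum_vertex_zero` ∕ `_coneVertex_one∕two`, ★ `dsCellDatum_reach`,
★ `exists_lower_of_ne`, ★ `dsCellDatum_casimirScalar`, part 1's `casimirScalar_eq_of_hasChiScalars`).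
[cite: Rogawski1990, §12.3 pp. 176–178] [cite: Kovacevic2021, §3 Thm 2–3, Remark 3; §4 Thm 4–5] [cite: BorelWallach2000, VI §4 4.10–4.12] -/
theorem datumUnitaryDual_at_regular : ∀ (a b c : ℤ), IsRegularParam a b c → ∀ (j : Fin 3) (𝒟 : SU21Datum),
    LieModule.IsIrreducible ℂ (Matrix (Fin 3) (Fin 3) ℂ) 𝒟.V → IsUnitarizable 𝒟 →
    HasChiScalars (σOfRecord 𝒟 (centralOf a b c)) (casimirOf a b c) (centralOf a b c) →
    (∃ s : ℂ, HasCubicScalar (σOfRecord 𝒟 (centralOf a b c)) s ∧ HasCubicPin (dsClsOfRecord a b c j) s) →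
    ∃ i : Fin 3, 𝒟.S = (dsCellDatum i a b c).S ∧
      (∀ n m : ℤ, 𝒟.A n m * 𝒟.D (n + 1) (m + 3) = (dsCellDatum i a b c).A n m * (dsCellDatum i a b c).D (n + 1) (m + 3)) ∧
      (∀ n m : ℤ, 𝒟.B n m * 𝒟.C (n + 1) (m - 3) = (dsCellDatum i a b c).B n m * (dsCellDatum i a b c).C (n + 1) (m - 3)) := by
  intro a b c h j 𝒟 hirr hU hχ hcub
  obtain ⟨s, hs, hpin⟩ := hcub
  haveI := hirr
  have hconn : ∀ x ∈ 𝒟.S, ∀ y ∈ 𝒟.S, 𝒟.Reach x y := forall_reach_of_isIrreducible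
  obtain ⟨⟨n₀, m₀⟩, h₀, h₀D, h₀C, -⟩ := exists_isLocalMin (𝒟 := 𝒟) 𝒟.nonempty_S_of_isIrreducible
  have hκ : ∀ m : ℤ, ((1 : ℤ), m) ∈ 𝒟.S → 𝒟.casimirScalar 1 m = ((casimirOf a b c : ℤ) : ℂ) - ((centralOf a b c : ℤ) : ℂ) ^ 2 / 3 :=
    fun m hm => casimirScalar_eq_of_hasChiScalars 𝒟 hirr hχ hm
  have hdown : ∀ n m : ℤ, (n, m) ∈ 𝒟.S → (n, m) ≠ (n₀, m₀) →
      𝒟.A (n - 1) (m - 3) * 𝒟.D n m ≠ 0 ∨ 𝒟.B (n - 1) (m + 3) * 𝒟.C n m ≠ 0 :=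
    fun n m hy hne => exists_lower_of_ne hconn h₀ h₀D h₀C hy hne
  -- the continuation against the cell `i`, given that `(n₀, m₀)` is its vertex
  have cont : ∀ i : Fin 3, (n₀, m₀) ∈ (dsCellDatum i a b c).S →
      (n₀ - 1, m₀ - 3) ∉ (dsCellDatum i a b c).S → (n₀ - 1, m₀ + 3) ∉ (dsCellDatum i a b c).S →
      ∃ i : Fin 3, 𝒟.S = (dsCellDatum i a b c).S ∧
        (∀ n m : ℤ, 𝒟.A n m * 𝒟.D (n + 1) (m + 3) = (dsCellDatum i a b c).A n m * (dsCellDatum i a b c).D (n + 1) (m + 3)) ∧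
        (∀ n m : ℤ, 𝒟.B n m * 𝒟.C (n + 1) (m - 3) = (dsCellDatum i a b c).B n m * (dsCellDatum i a b c).C (n + 1) (m - 3)) := by
    intro i hi hiD hiC
    have key := mem_iff_and_products_eq_of_vertex_of_casimir (𝒟₁ := 𝒟) (𝒟₂ := dsCellDatum i a b c) (x₀ := (n₀, m₀)) h₀ hi hdown
      (fun n m hy hne => exists_lower_of_ne (dsCellDatum_reach h i) hi hiD hiC hy hne) hκ
      (fun m hm => dsCellDatum_casimirScalar i hm)
    exact ⟨i, Set.ext fun ⟨n, m⟩ => (key n m).1, fun n m => (key n m).2.1, fun n m => (key n m).2.2⟩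
  rcases vertex_eq_of_pins h j 𝒟 hirr hU hχ hs hpin h₀ h₀D h₀C with hv | hv | hv <;>
    obtain ⟨rfl, rfl⟩ := Prod.mk.injEq _ _ _ _ ▸ hv
  · obtain ⟨hv0, hv0D, hv0C, -⟩ := dsCellDatum_vertex_zero h
    exact cont 0 hv0 hv0D hv0C
  · obtain ⟨hv1, hv1D, hv1C⟩ := dsCellDatum_coneVertex_one h
    exact cont 1 hv1 hv1D hv1C
  · obtain ⟨hv2, hv2D, hv2C⟩ := dsCellDatum_coneVertex_two h
    exact cont 2 hv2 hv2D hv2C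

/-- **BY-NAME TIE**: the head IS the socket statement ★ `DatumUnitaryDualStmt` of the Q12 glue (`sig_K2E1bDatumUnitaryDual := datumUnitaryDualStmt_holds`).
[cite: Rogawski1990, §12.3 pp. 176–178] -/
theorem datumUnitaryDualStmt_holds : U8.DatumUnitaryDualStmt :=
  datumUnitaryDual_at_regular

end Main

end Summit.HodgeConjecture.HodgeConjecture.Cruxes.H413.K2E1bDatumUnitaryDual

end
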